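import Summits.BirchSwinnertonDyer.BirchSwinnertonDyer.Theorems.KatoDescentPotSupersingularReducibleKatoMemberNodes
import Summits.BirchSwinnertonDyer.BirchSwinnertonDyer.Theorems.ByReductionTypeAtTwoAdditiveKatoFineConjAReducible
import Literature.NumberTheory.EllipticCurves.Kato2004.MemberHullInputsTwo
import Literature.NumberTheory.EllipticCurves.Kato2004.IwasawaCohomologyExistsProofs
import Literature.NumberTheory.EllipticCurves.Rank1Residual.GVParityTwistTransportProofs
import Summits.BirchSwinnertonDyer.Rank1Residual.O6.X3KatoMemberBound
import HarnessLib

/-!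
# Crux `AdditiveRankZeroAtTwo` (K4 item 19098), `E[2]`-REDUCIBLE sub-block: KATO'S MEMBER BOUND AT `p = 2`
# from the named fact `Kato2004.exists_memberHullInputs_two` through the tree's PROVED hull descent, and the
# kernel route member bound ⟹ hU3 = `MissingUpperBoundAt W 2` on the classes with small `2`-torsion
# (Cassels transport + Cassels–Tate parity — the T-X3K♯ route of `O6/X3KatoMemberBound.lean` at `p = 2`)

Seat `bsd-2adic-addL2x` GEN 10 (cell `bsd-2adic`, rung K4, crux stmt-BirchSwinnertonDyer-19098
`AdditiveRankZeroAtTwo`, line add_twist_overK v2, stub `stub_addDefectUpper` = hU3; road R-B45″ of the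
GEN 9 memo §6). `--supports 19098 --as helper`; closes nothing at the `∀`-level. HONEST FRAMING: BSD is
not proved by any of this; the `E[2]`-reducible sub-block of hU3 is now «Kato's member bound at `2`»
resting on ONE named transcription (`exists_memberHullInputs_two`, the `p = 2` twin of bsd-potss-rkm's
referee-verified `exists_memberHullInputs`) plus PRINT by name (Lim 2017 Thm. 3.5 at `2`,
Ferrero–Washington, Cassels, Cassels–Tate, GZK, modularity).

* §1 `katoMemberShaBound_two_of_memberHullInputs_two` — the node T-X3K at `p = 2`: for `W/ℚ` globally
  minimal, non-CM, additive potentially good at `2`, `E[2]` reducible, `L(W,1) ≠ 0`, `Ш(W)` finite, Kato's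
  member `W' ∼ W` satisfies `ord₂ #Ш(W')[2^∞] + v₂ Tam(W') ≤ ord₂(L(W',1)/Ω(W')) + 3·ord₂ #W'(ℚ)_tors`.
  Proof = rkm's node proof (`ReducibleKatoMemberOfInputs.katoMemberShaBoundOfReducible_of_memberHullInputs`)
  at `p = 2`: member + `ZetaBody` datum from the fact ⟶ (A) at `(W',2)` discharged BY NAME
  (`AddKatoTwo.conjA_two_of_not_irreducible`; `W'[2]` reducible by `not_hasIrreducibleModPGaloisRep_of_isIsogenous`)
  ⟶ cyclotomic tower (PROVED) ⟶ `I` (`nonempty_iwasawaH1Data_holds`, PROVED) ⟶ the lift `𝐲`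
  (`existsUnique_lift_of_zetaBody_two`) ⟶ package `K` ⟶ `valuation_add_padicValNat_coinvariants_le_of_hull_smul`
  + `K.count` ⟶ cancel.
* §2 `missingUpperBoundAt_two_of_katoMember_two` — T-X3K♯ at `2`: the member bound ⟹ `MissingUpperBoundAt W 2`
  for every such `W` of analytic rank `0` whose isogeny class has NO point of order `4`·(odd) beyond order
  `2` in its `2`-primary torsion (`¬ 4 ∣ #W''(ℚ)_tors` for all `W'' ∼ W`) and with `ord₂ #Ш_an(W)` even
  (`O6.exists_shaAn_le_add_torsion_of_katoCurrency`, `TwistComparison.defectAgreeAt_of_isIsogenous`,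
  `isSquare_shaOrder_of_casselsTate` — the proof of `O6.x3PotGoodRankZeroUpperOfSmallClassTorsion_of_katoMember`
  word for word).
* §3 `addBlock_reducibleUpper_two_of_smallTorsion` — the block form keyed like hypothesis (I2) of
  `AddKatoTwo.additiveRankZeroAtTwo_of_residual` (`¬CM → r_an = 0 → DefectAtLeastThree → ¬irreducible →
  MissingUpperBoundAt W 2`), restricted to the two side conditions.

References: [Kato2004Asterisque] Thm. 12.4–12.6 (pp. 221–222), Lemma 13.10 (1) (p. 230), 13.14 (p. 234),
Thm. 14.5 (p. 236), §14.8 (p. 238), §14.14–Lemma 14.15 (pp. 243–244), Prop. 14.16 (2) (p. 244);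
[Wuthrich2014] Lemma 12; [GreenbergLNM1716] Prop. 4.13, §3; [Lim2017FineSelmer] Thm. 3.5;
[FerreroWashington1979]; [Cassels1965ArithmeticVIII]; [MilneADT2006] I.7.3; [SilvermanAEC2009] X.4.14;
[Miller2011LMS] Def. 1.1.
-/

set_option autoImplicit false
set_option linter.dupNamespace false

noncomputable section

open scoped Classical

namespace Summit.BirchSwinnertonDyer.BirchSwinnertonDyer.Theorems.AddKatoTwo

open WeierstrassCurve Literature.NumberTheory.EllipticCurves
  Literature.NumberTheory.EllipticCurves.ModularForms
  Literature.NumberTheory.EllipticCurves.Kato2004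
  Literature.NumberTheory.EllipticCurves.IwasawaAlgebra
  Literature.NumberTheory.EllipticCurves.Rank1Residual
  Literature.NumberTheory.EllipticCurves.Rank1Residual.Typed
  Literature.NumberTheory.IwasawaTheory
  Summit.BirchSwinnertonDyer.Rank1Residual Summit.BirchSwinnertonDyer.Rank1Residual.Additive
  Summit.BirchSwinnertonDyer.Rank1Residual.X5.AddTwoL2

/-! ## §1 Kato's member bound at `p = 2` (the node T-X3K at `2`) -/

/-- **Kato's member bound at `p = 2` for REDUCIBLE `E[2]`** — granted modularity (`hmod`), the named fact
`Kato2004.exists_memberHullInputs_two` (`hin`: Kato Thm. 12.4, 12.5 (1)–(3), 12.6 + 13.10 (1) + 13.14, §14.14,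
14.5 (1)(2) and the rank-`0` count at `T = V_{ℤ₂}(f)(1)`), Lim 2017 Thm. 3.5 at `2` (`hLim2`) and
Ferrero–Washington (`hFW`) BY NAME: for `W/ℚ` globally minimal, non-CM, additive and potentially good at
`2`, `W[2]` reducible, `L(W,1) ≠ 0`, `Ш(W)` finite, Kato's member `W' ∼ W` is globally minimal with
`Ш(W')` finite and `ord₂ #Ш(W')[2^∞] + v₂ Tam(W') ≤ ord₂(L(W',1)/Ω(W')) + 3·ord₂ #W'(ℚ)_tors`.
Statement (A) at `(W', 2)` is DISCHARGED (`conjA_two_of_not_irreducible`; `W'[2]` is reducible with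
`W[2]`); `𝐇¹_Γ` exists by the tree theorem `nonempty_iwasawaH1Data_holds`; the rest is rkm's node proof at
`p = 2` with `existsUnique_lift_of_zetaBody_two`. Conditional on `hmod`, `hin`, `hLim2`, `hFW`.
[cite: Kato2004Asterisque, Thm. 12.6 (p. 222), Lemma 13.10 (1) (p. 230), 13.14 (p. 234), §14.14 and Lemma 14.15 (pp. 243–244), Prop. 14.16 (2) (p. 244), §14.8 (p. 238)]
[cite: Lim2017FineSelmer, §3 Thm. 3.5] [cite: FerreroWashington1979, Theorem] -/
theorem katoMemberShaBound_two_of_memberHullInputs_two (hmod : exists_isNewformOf)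
    (hin : Kato2004.exists_memberHullInputs_two)
    (hLim2 : Lim2017.thm35_at_two_fineSelmerDual_moduleFinite_of_classicalMuVanishes_of_le_divisionField_four)
    (hFW : ferreroWashington1979_classicalMuVanishes)
    (W : WeierstrassCurve ℚ) [W.IsElliptic] [W.IsGloballyMinimal] (hcm : ¬ W.HasCM)
    (hng : ¬ W.HasGoodReductionAtPrime 2) (hnm : ¬ W.HasMultiplicativeReductionAtPrime 2)
    (hj : 0 ≤ padicValRat 2 W.j) (hred : ¬ W.HasIrreducibleModPGaloisRep 2)
    (hL : W.entireLFunction 1 ≠ 0) (hfin : Finite W.sha) :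
    ∃ (W' : WeierstrassCurve ℚ) (_ : W'.IsElliptic) (_ : W'.IsGloballyMinimal),
      IsIsogenous W W' ∧ Finite W'.sha ∧
      ∃ q : ℚ, W'.entireLFunction 1 / (W'.realPeriodRat : ℂ) = (q : ℂ) ∧
        (padicValNat 2 (Nat.card (AddCommGroup.primaryComponent W'.sha 2)) : ℤ) +
            padicValNat 2 W'.tamagawaProduct ≤
          padicValRat 2 q + 3 * (padicValNat 2 W'.torsionOrder : ℤ) := by
  -- Kato's member `W'` and the fact's data at it
  obtain ⟨W', hE', hM', hiso, hrest⟩ := hin W hcm hng hnm hj hred hL hfin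
  haveI := hE'
  haveI := hM'
  haveI : ContinuousSMul ℤ_[2] (W'.tateModule 2) := TateModule.continuousSMul_padicInt
  haveI : Module.Free ℤ_[2] (W'.tateModule 2) := W'.module_free_tateModule_holds 2
  haveI : Module.Finite ℤ_[2] (W'.tateModule 2) := W'.module_finite_tateModule_holds 2
  -- statement (A) at `(W', 2)`: `W'[2]` is reducible with `W[2]`; Lim@2 + Ferrero–Washington BY NAME
  have hred' : ¬ W'.HasIrreducibleModPGaloisRep 2 := not_hasIrreducibleModPGaloisRep_of_isIsogenous hiso hred
  have hA' := conjA_two_of_not_irreducible hLim2 hFW W' hred'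
  -- a newform of `W` (modularity) and a family of complex embeddings of the cyclotomic fields
  haveI : NeZero (W.conductorNorm ℤ) := ⟨(W.conductorNorm_pos_holds).ne'⟩
  obtain ⟨f, hf⟩ := hmod W
  obtain ⟨κ', Λ', c, d, a, A, z, x, -, -, -, -, hbody, hpack⟩ :=
    hrest hA' f hf (fun m => Classical.arbitrary _)
  -- the cyclotomic `ℤ₂`-tower with a topological generator (PROVED), the pinned `𝐇¹_Γ(T₂W')`, the lift `𝐲`
  obtain ⟨κ, hκ, γ, hγ, -⟩ := exists_isCyclotomic_isTopGenerator_isCyclotomicVariable_holds 2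
  obtain ⟨I⟩ := nonempty_iwasawaH1Data_holds W' 2 κ γ hκ hγ
  obtain ⟨y, hy⟩ :=
    (IwasawaH1Data.existsUnique_lift_of_zetaBody_two W' hκ I f (fun m => Classical.arbitrary _)
      κ' Λ' c d a A z x hbody).exists
  -- the package at `(I, 𝐲)`
  obtain ⟨K⟩ := hpack κ γ hκ hγ I y hy
  have hfin' : Finite W'.sha := (IsIsogenous.shaFinite_iff_shaFinite hiso).mp hfin
  haveI := K.finite_H
  haveI := K.torsionFree_H
  haveI := K.finite_F
  haveI := K.torsionFree_F
  haveI := K.finite_H2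
  -- the divisibility for the hull at EVERY height-one prime: off `(2)` Thm. 12.5 (3), at `(2)` `μ = 0`
  have hdiv : ∀ 𝔮 : PrimeSpectrum (IwasawaAlgebra 2), 𝔮.asIdeal.height = 1 →
      Module.lengthAt (IwasawaAlgebra 2) K.H2 𝔮 ≤
        Module.lengthAt (IwasawaAlgebra 2) (K.F ⧸ (IwasawaAlgebra 2) ∙ K.z) 𝔮 := by
    intro 𝔮 h𝔮
    by_cases hq : 𝔮.asIdeal = augIdealP 2
    · have hμ : (Module.lengthAt (IwasawaAlgebra 2) K.H2 𝔮).toNat = 0 := by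
        rw [← muInvariant_eq_toNat_lengthAt 2 K.H2 𝔮 hq]; exact K.mu_H2
      have hfinl : Module.lengthAt (IwasawaAlgebra 2) K.H2 𝔮 ≠ ⊤ :=
        IwasawaAlgebra.lengthAt_ne_top_of_isTorsion K.H2 K.isTorsion_H2 𝔮 (le_of_eq h𝔮)
      have h0' : Module.lengthAt (IwasawaAlgebra 2) K.H2 𝔮 = 0 := by
        rw [← ENat.coe_toNat hfinl, hμ]; rfl
      rw [h0']
      exact bot_le
    · exact K.divisibility_offP 𝔮 h𝔮 hq
  -- the hull descent with the multiplier (PROVED module theory over `ℤ₂⟦X⟧`)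
  have hhull := valuation_add_padicValNat_coinvariants_le_of_hull_smul K.j K.j_injective
    K.finite_coker K.z K.z_ne_zero K.isTorsion_quotient K.isTorsion_H2 hdiv y K.lam
    K.lam_constantCoeff_ne_zero K.j_y K.ι K.π K.ι_injective K.π_surjective K.exact_ι_π
    K.finite_coinvariants_H2 K.index_ne_zero
  -- the count; the multiplier and the `𝐇²` terms cancel
  obtain ⟨q, hq, hcount⟩ := K.count
  refine ⟨W', hE', hM', hiso, hfin', q, hq, ?_⟩
  have hhull' : ((PowerSeries.constantCoeff K.lam).valuation : ℤ) +
      (padicValNat 2 (Nat.card (coinvariants 2 K.H2)) : ℤ) ≤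
      (padicValNat 2 (Nat.card (K.A ⧸ (IwasawaAlgebra 2) ∙ K.ι (Submodule.Quotient.mk y))) : ℤ) := by
    exact_mod_cast hhull
  linarith

/-! ## §2 The kernel route at `2`: member bound ⟹ hU3 on the classes with small `2`-torsion (T-X3K♯ at `2`) -/

/-- **hU3 = `MissingUpperBoundAt W 2` on the `E[2]`-REDUCIBLE, additive, potentially good at `2`,
analytic-rank-`0` curves whose isogeny class has `2`-primary torsion of order exactly `2` on every
member and whose `ord₂ #Ш_an` is even** — granted `hmod`/`hrat` (modularity, both spellings),
`exists_memberHullInputs_two` (`hin`), Lim@2 (`hLim2`), Ferrero–Washington (`hFW`), Cassels' isogeny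
invariance (`hCassels`), the Cassels–Tate pairing (`hCT`) and GZK (`hGZK`) BY NAME. Proof = the kernel
route `O6.x3PotGoodRankZeroUpperOfSmallClassTorsion_of_katoMember` at `p = 2`: at Kato's member `W' ∼ W`
(§1; `L(W,1) ≠ 0` by modularity, `Ш(W)` finite by GZK) `ord₂ #Ш(W') ≤ ord₂ #Ш_an(W') + t(W')`
(`O6.exists_shaAn_le_add_torsion_of_katoCurrency`) with `t(W') ≤ 1` (no point of order `4` or two
independent points of order `2` in the class); Cassels transports the defect to `W`
(`TwistComparison.defectAgreeAt_of_isIsogenous`); `ord₂ #Ш(W)` is even (Cassels–Tate) and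
`ord₂ #Ш_an(W)` is even (hypothesis), so the slack `≤ 1` is `≤ 0`. Conditional on the named facts;
nothing else assumed. [cite: Kato2004Asterisque, Prop. 14.16 (2) (p. 244)] [cite: Cassels1965ArithmeticVIII]
[cite: MilneADT2006, Thm. I.7.3] [cite: SilvermanAEC2009, Thm. X.4.14] [cite: Miller2011LMS, Def. 1.1] -/
theorem missingUpperBoundAt_two_of_katoMember_two (hmod : exists_isNewformOf)
    (hin : Kato2004.exists_memberHullInputs_two)
    (hLim2 : Lim2017.thm35_at_two_fineSelmerDual_moduleFinite_of_classicalMuVanishes_of_le_divisionField_four)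
    (hFW : ferreroWashington1979_classicalMuVanishes)
    (hCassels : bsdRHS_eq_of_isIsogenous) (hCT : exists_casselsTate_pairing (K := ℚ))
    (hGZK : rank_eq_analyticRank_of_analyticRank_le_one) (hrat : hasEntireLFunction_rat)
    (W : WeierstrassCurve ℚ) [W.IsElliptic] [W.IsGloballyMinimal] (hcm : ¬ W.HasCM)
    (hng : ¬ W.HasGoodReductionAtPrime 2) (hnm : ¬ W.HasMultiplicativeReductionAtPrime 2)
    (hj : 0 ≤ padicValRat 2 W.j) (hred : ¬ W.HasIrreducibleModPGaloisRep 2)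
    (hr : W.analyticRank = 0)
    (hsmall : ∀ (W' : WeierstrassCurve ℚ) [W'.IsElliptic], IsIsogenous W W' → ¬ 2 ^ 2 ∣ W'.torsionOrder)
    (heven : ∀ q : ℚ, shaAn W = (q : ℂ) → Even (padicValRat 2 q)) :
    MissingUpperBoundAt W 2 := by
  -- `L(W,1) ≠ 0` (modularity) and `Ш(W)` finite (GZK)
  have hL : W.entireLFunction 1 ≠ 0 := (W.analyticRank_eq_zero_iff_holds (hrat W)).mp hr
  have hr1 : W.analyticRank ≤ 1 := by rw [hr]; exact zero_le_one
  have hfinW : W.ShaFinite := (hGZK W hr1).2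
  -- Kato's member `W'`
  obtain ⟨W', hE', hM', hiso, hfin', q, hq, hle⟩ :=
    katoMemberShaBound_two_of_memberHullInputs_two hmod hin hLim2 hFW W hcm hng hnm hj hred hL hfinW
  haveI := hE'
  haveI := hM'
  have hfin'S : W'.ShaFinite := hfin'
  have hr' : W'.analyticRank = 0 := by rw [← analyticRank_eq_of_isIsogenous' hiso, hr]
  -- Miller currency at `W'`, with the torsion slack `t(W') ≤ 1`
  obtain ⟨q', hq', hW'⟩ := O6.exists_shaAn_le_add_torsion_of_katoCurrency hGZK hrat W' 2 hr' hfin' hq hle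
  have ht1 : padicValNat 2 W'.torsionOrder ≤ 1 :=
    padicValNat_le_one_of_not_sq_dvd W'.torsionOrder_pos_holds.ne' (hsmall W' hiso)
  -- Cassels: transport the defect from `W'` to `W`
  obtain ⟨r, r', hr0, hrW, hδ⟩ :=
    TwistComparison.defectAgreeAt_of_isIsogenous W' W 2 hCassels hrat hiso.symm_of_isElliptic hfin'S hq'
  have hrq : r = q' := by exact_mod_cast hr0.symm.trans hq'
  rw [hrq] at hδ
  -- parity at `W`
  have hsqW : IsSquare W.shaOrder := isSquare_shaOrder_of_casselsTate hCT W hfinW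
  obtain ⟨a, ha⟩ := O6.even_padicValNat_of_isSquare (p := 2) hsqW (W.shaOrder_pos hfinW).ne'
  obtain ⟨b, hb⟩ := heven r' hrW
  refine ⟨r', hrW, ?_⟩
  have ht1' : ((padicValNat 2 W'.torsionOrder : ℕ) : ℤ) ≤ 1 := by exact_mod_cast ht1
  have ha' : ((padicValNat 2 W.shaOrder : ℕ) : ℤ) = (a : ℤ) + (a : ℤ) := by exact_mod_cast ha
  omega

/-! ## §3 The block form (hypothesis (I2) of `additiveRankZeroAtTwo_of_residual`, restricted to the side conditions) -/

/-- **hU3 on the `E[2]`-REDUCIBLE defect-`≥ 3` sub-block, on the classes with small `2`-torsion and even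
`ord₂ #Ш_an`** — the binder of hypothesis `hUred` (I2) of `AddKatoTwo.additiveRankZeroAtTwo_of_residual`
(`¬CM → r_an = 0 → DefectAtLeastThree → ¬ irreducible → MissingUpperBoundAt W 2`) with the two
decidable-per-class side conditions added, from `exists_memberHullInputs_two` + PRINT BY NAME
(`DefectAtLeastThree` ⟹ additive at `2` and, being not quadratically semistabilisable, not potentially
multiplicative, i.e. `0 ≤ ord₂ j`, `quadSemistabilisable_of_potMult`). Conditional;
nothing asserted. [cite: Kato2004Asterisque, Prop. 14.16 (2) (p. 244)] [cite: Cassels1965ArithmeticVIII]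
[cite: SilvermanAEC2009, Thm. X.4.14] -/
theorem addBlock_reducibleUpper_two_of_smallTorsion (hmod : exists_isNewformOf)
    (hin : Kato2004.exists_memberHullInputs_two)
    (hLim2 : Lim2017.thm35_at_two_fineSelmerDual_moduleFinite_of_classicalMuVanishes_of_le_divisionField_four)
    (hFW : ferreroWashington1979_classicalMuVanishes)
    (hCassels : bsdRHS_eq_of_isIsogenous) (hCT : exists_casselsTate_pairing (K := ℚ))
    (hGZK : rank_eq_analyticRank_of_analyticRank_le_one) (hrat : hasEntireLFunction_rat) :
    ∀ (W : WeierstrassCurve ℚ) [W.IsElliptic] [W.IsGloballyMinimal], ¬ W.HasCM → W.analyticRank = 0 →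
      DefectAtLeastThree W → ¬ W.HasIrreducibleModPGaloisRep 2 →
      (∀ (W' : WeierstrassCurve ℚ) [W'.IsElliptic], IsIsogenous W W' → ¬ 2 ^ 2 ∣ W'.torsionOrder) →
      (∀ q : ℚ, shaAn W = (q : ℂ) → Even (padicValRat 2 q)) →
      MissingUpperBoundAt W 2 := by
  intro W _ _ hcm hr hdef hred hsmall heven
  haveI : Fact (Nat.Prime 2) := ⟨Nat.prime_two⟩
  obtain ⟨⟨hng, hnm⟩, hnq⟩ := hdef
  have hj : 0 ≤ padicValRat 2 W.j := by
    by_contra hlt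
    exact hnq (quadSemistabilisable_of_potMult W ⟨⟨hng, hnm⟩, lt_of_not_ge hlt⟩)
  exact missingUpperBoundAt_two_of_katoMember_two hmod hin hLim2 hFW hCassels hCT hGZK hrat W hcm hng hnm
    hj hred hr hsmall heven

end Summit.BirchSwinnertonDyer.BirchSwinnertonDyer.Theorems.AddKatoTwo

end
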